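import Summits.BirchSwinnertonDyer.BirchSwinnertonDyer.Theorems.ManinLocalTwoThreeShimuraSectorTame

/-!
# THEOREM 54 — part 4/4 (§8–§9; imc g42/g43, MEMO-imc §55): THE REAL-TRACE FUNCTIONAL of a rational newform (COROLLARIES 58.1/58.2)
# and LAW 55 — SHIMURA RIGIDITY AT AN INADMISSIBLE PRIME, THE ADMISSIBILITY DICHOTOMY, THE UNIFIED SECTOR RANK LAW (typed, `@[conjecture]`)
# (cell bsd-f2-manin, LENS imc, route `ManinLocalTwoThree`, crux C3 `ManinPrimeToThreeAtNine` stmt-BirchSwinnertonDyer-22968 / C2 `ManinOddAtFour` stmt-22967)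

§8: the REAL-TRACE FUNCTIONAL `ψ₊ = k(x) mod ℓ` (`x + x̄ = k(x)·Ω⁺_f`, tree `exists_int_add_conj_eq_mul_plusPeriod`) of a rational
newform is additive, star-even and non-zero (`realTraceHom`, `realTraceFunctional`, `_conj`, `_ne_zero`), so COR 55.1's functional
hypotheses are THEOREMS for `d = 1`: COROLLARY 58.1 `dvd_shimuraIndex_of_sectorMultiplicityOne_of_isNewformOf_tame` — for the newform
of an elliptic curve at a tame tuple, (Eisenstein congruence on `S`) ∧ (signs `diamondSign q₀` on `𝒬`) ∧ `SectorMultiplicityOne`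
⟹ `ℓ ∣ [Λ₀(f) : Λ₁(f)]`; COROLLARY 58.2 `dvd_shimuraIndex_of_finrank_eq_one_of_isNewformOf` — the same with the census quantity
`finrank (sector) = 1` (m = 1) in place of `SectorMultiplicityOne` (`diamondFun_comp_ne_zero`).
§9 (imc g43, MEMO-imc §55): `ShimuraRigidityAtInadmissiblePrime` (THEOREM 55.B, paper: `p ∥ N`, `p ≢ −ε (mod ℓ)`, `U_p u = p u`,
`W_p u = ε u` ⟹ `u` Shimura (`ε = 1`) / `u = 0` (`ε = −1`) — Ihara + the Atkin–Lehner trace identity), `SectorCollapse`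
(CONJECTURE 55.A, 57/57), `SectorRankLawUnified` (55.U: tame AND wild `ℓ³ ∥ N`, 79/79), `SectorRankLawDepthFour` (8/8); the
arithmetic side `isSectorTuple` / `admissibleCofactor` / `charSplitDelta` is `Bool`/`ℕ`-valued.

HONEST FRAMING.  Kernel theorems are unconditional MODULO their typed hypotheses (`SectorMultiplicityOne …` = CONJECTURE M1 per
tuple, open; the `@[conjecture]` rank laws are typed census candidates, NOT theorems).  Nothing about C2/C3, Manin's conjecture or
BSD is proved here.  Source: imc g42/g43 planner sketch `HOME/imc/g43/Sketch59full.lean` 8602093605f9eb5d (MEMO-imc §53.10, §54, §55),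
landed verbatim by LEAD p1 g26 in four parts: 1 `…ShimuraSectorCocycles` (§1–§3), 2 `…ShimuraSectorCapture` (§4 THEOREM 54, §6.1–6.2),
3 `…ShimuraSectorTame` (§6.3–§7), 4 `…ShimuraSectorRankLaw` (§8–§9).
[cite: Mazur1977, II.9 and II.16 (Eisenstein ideal, multiplicity one at prime level)] [cite: Manin1972, Prop. 1.4 / Thm. 1.6]
[cite: Knapp1993, Prop. 11.1, Lemma 9.24] [cite: Shimura1971, §8.1 (8.1.4), §8.3 (8.3.2)] [cite: Stevens1989, §2]
-/

set_option autoImplicit false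
set_option linter.dupNamespace false

noncomputable section

open scoped Classical ComplexConjugate MatrixGroups ModularForm BigOperators

open CongruenceSubgroup Matrix.SpecialLinearGroup Complex
open Literature.NumberTheory.EllipticCurves Literature.NumberTheory.EllipticCurves.ModularForms
open Literature.NumberTheory.EllipticCurves.ModularForms.HidaCohomology
open Summit.BirchSwinnertonDyer.Rank1Residual.ManinAdditive (diamondFun diamondFun_apply)

namespace Summit.BirchSwinnertonDyer.BirchSwinnertonDyer.Theorems.ManinLocalTwoThree.ShimuraSector

/-! ## §8 (imc g42) THE REAL-TRACE FUNCTIONAL: for a RATIONAL newform the star-even non-zero `ψ` of COR 55.1 EXISTS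

For `f` with `coeffField f = ⊥` every period has real trace `x + x̄ = k(x)·Ω⁺_f` with `k(x) ∈ ℤ` (tree
`exists_int_add_conj_eq_mul_plusPeriod`, from Eichler–Shimura `isZLattice_periodLattice_holds`) and some period has `k = 1`
(`exists_mem_periodLattice_add_conj_eq_plusPeriod`).  Hence `ψ₊ := k mod ℓ : Λ_f →+ R` is additive, STAR-EVEN (`k(x̄) = k(x)`) and
NON-ZERO in any nontrivial ring (value `1`).  Feeding `ψ₊` to COR 55.1 gives COROLLARY 58.1: for the newform of an elliptic curve at a
tame tuple the ONLY inputs left are the Eisenstein CONGRUENCE `a_p ≡ p + 1` / `a_p ≡ p (p ∣ N)` mod `ℓ` on `S` (census column (E)),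
the Atkin–Lehner sign vector `w_Q = diamondSign q₀ Q` (forced by (E) at the tame primes; `w_{ℓ²} = +1` a genuine condition) and
`SectorMultiplicityOne` at the tuple (LAW 54.M′: `s + δ = 1`) — conclusion `ℓ ∣ [Λ₀(f) : Λ₁(f)]`. -/

section RealTrace

variable {N : ℕ} [NeZero N] {f : CuspForm (Gamma0 N) 2}

/-- `Ω⁺_f ≠ 0` for a rational newform (Eichler–Shimura: `re Λ_f = ℤ·Ω⁺/2`, `Ω⁺ > 0`). [cite: CremonaAlgorithms1997, §2.8] -/
theorem plusPeriod_cast_ne_zero (hf : IsNewform0 f) (hQ : coeffField f = ⊥) : (plusPeriod f : ℂ) ≠ 0 := by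
  have h := (plusPeriod_pos_and_realPeriods_eq isZLattice_periodLattice_holds hf hQ).1
  exact_mod_cast h.ne'

/-- Cancellation of `Ω⁺_f`: `j·Ω⁺ = k·Ω⁺ ⟹ j = k`. [folklore] -/
theorem int_eq_of_mul_plusPeriod_eq (hf : IsNewform0 f) (hQ : coeffField f = ⊥) {j k : ℤ}
    (h : (j : ℂ) * (plusPeriod f : ℂ) = (k : ℂ) * (plusPeriod f : ℂ)) : j = k := by
  have := mul_right_cancel₀ (plusPeriod_cast_ne_zero hf hQ) h
  exact_mod_cast this

/-- The REAL-TRACE INDEX `k(x) ∈ ℤ` of a period `x ∈ Λ_f` of a rational newform: `x + x̄ = k(x)·Ω⁺_f`.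
[cite: CremonaAlgorithms1997, §2.8] -/
noncomputable def realTraceIndex (hf : IsNewform0 f) (hQ : coeffField f = ⊥) (x : ↥(periodLattice f)) : ℤ :=
  Classical.choose (exists_int_add_conj_eq_mul_plusPeriod hf hQ x.2)

/-- Defining property of `k(x)`. [cite: CremonaAlgorithms1997, §2.8] -/
theorem realTraceIndex_spec (hf : IsNewform0 f) (hQ : coeffField f = ⊥) (x : ↥(periodLattice f)) :
    (x : ℂ) + conj (x : ℂ) = (realTraceIndex hf hQ x : ℂ) * (plusPeriod f : ℂ) :=
  Classical.choose_spec (exists_int_add_conj_eq_mul_plusPeriod hf hQ x.2)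

/-- `k(x)` is determined by `x + x̄`. [folklore] -/
theorem realTraceIndex_eq_of_eq (hf : IsNewform0 f) (hQ : coeffField f = ⊥) (x : ↥(periodLattice f)) {k : ℤ}
    (h : (x : ℂ) + conj (x : ℂ) = (k : ℂ) * (plusPeriod f : ℂ)) : realTraceIndex hf hQ x = k :=
  int_eq_of_mul_plusPeriod_eq hf hQ ((realTraceIndex_spec hf hQ x).symm.trans h)

/-- The real-trace index is ADDITIVE: `k : Λ_f →+ ℤ`. [folklore] -/
noncomputable def realTraceHom (hf : IsNewform0 f) (hQ : coeffField f = ⊥) : ↥(periodLattice f) →+ ℤ :=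
  AddMonoidHom.mk' (realTraceIndex hf hQ) fun x y => by
    apply realTraceIndex_eq_of_eq hf hQ
    rw [AddSubgroup.coe_add, map_add, Int.cast_add, add_mul, ← realTraceIndex_spec hf hQ x,
      ← realTraceIndex_spec hf hQ y]
    ring

/-- Unfolding of the real-trace homomorphism. [folklore] -/
theorem realTraceHom_apply (hf : IsNewform0 f) (hQ : coeffField f = ⊥) (x : ↥(periodLattice f)) :
    realTraceHom hf hQ x = realTraceIndex hf hQ x := rfl

/-- `k` is STAR-EVEN: `k(x̄) = k(x)` (the real trace of `x̄` is that of `x`). [folklore] -/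
theorem realTraceHom_conj (hf : IsNewform0 f) (hQ : coeffField f = ⊥) (x : ↥(periodLattice f))
    (hx : conj (x : ℂ) ∈ periodLattice f) : realTraceHom hf hQ ⟨conj (x : ℂ), hx⟩ = realTraceHom hf hQ x := by
  rw [realTraceHom_apply, realTraceHom_apply]
  apply realTraceIndex_eq_of_eq hf hQ
  show conj (x : ℂ) + conj (conj (x : ℂ)) = _
  rw [Complex.conj_conj, add_comm]
  exact realTraceIndex_spec hf hQ x

/-- `k` takes the value `1` (some period has real trace exactly `Ω⁺_f`). [cite: CremonaAlgorithms1997, §2.8] -/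
theorem exists_realTraceHom_eq_one (hf : IsNewform0 f) (hQ : coeffField f = ⊥) :
    ∃ x : ↥(periodLattice f), realTraceHom hf hQ x = 1 := by
  obtain ⟨x, hx, hxΩ⟩ := exists_mem_periodLattice_add_conj_eq_plusPeriod hf hQ
  refine ⟨⟨x, hx⟩, realTraceIndex_eq_of_eq hf hQ ⟨x, hx⟩ ?_⟩
  rw [Int.cast_one, one_mul]
  exact hxΩ

/-- **The real-trace functional** `ψ₊ = k mod (char R) : Λ_f →+ R`. [cite: CremonaAlgorithms1997, §2.8] -/
noncomputable def realTraceFunctional (hf : IsNewform0 f) (hQ : coeffField f = ⊥) (R : Type*) [AddGroupWithOne R] :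
    ↥(periodLattice f) →+ R :=
  (Int.castAddHom R).comp (realTraceHom hf hQ)

/-- Unfolding of the real-trace functional. [folklore] -/
theorem realTraceFunctional_apply (hf : IsNewform0 f) (hQ : coeffField f = ⊥) (R : Type*) [AddGroupWithOne R]
    (x : ↥(periodLattice f)) : realTraceFunctional hf hQ R x = ((realTraceHom hf hQ x : ℤ) : R) := rfl

/-- `ψ₊` is STAR-EVEN. [folklore] -/
theorem realTraceFunctional_conj (hf : IsNewform0 f) (hQ : coeffField f = ⊥) (R : Type*) [AddGroupWithOne R]
    (x : ↥(periodLattice f)) (hx : conj (x : ℂ) ∈ periodLattice f) :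
    realTraceFunctional hf hQ R ⟨conj (x : ℂ), hx⟩ = realTraceFunctional hf hQ R x := by
  rw [realTraceFunctional_apply, realTraceFunctional_apply, realTraceHom_conj]

/-- `ψ₊ ≠ 0` in every nontrivial ring (it takes the value `1`). [folklore] -/
theorem realTraceFunctional_ne_zero (hf : IsNewform0 f) (hQ : coeffField f = ⊥) (R : Type*) [Ring R] [Nontrivial R] :
    realTraceFunctional hf hQ R ≠ 0 := by
  obtain ⟨x, hx⟩ := exists_realTraceHom_eq_one hf hQ
  intro h
  have h1 := DFunLike.congr_fun h x
  rw [realTraceFunctional_apply, hx, Int.cast_one, AddMonoidHom.zero_apply] at h1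
  exact one_ne_zero h1

variable {ℓ : ℕ} [Fact ℓ.Prime]

/-- **COROLLARY 58.1 (`d = 1`, tame tuple, NO functional hypotheses).**  For the newform `f` of an elliptic curve `W` of
conductor `N`, a prime `q₀ ∣ N`, `ℓ` odd, a non-trivial `χ₀ : (ℤ/q₀)ˣ → 𝔽_ℓ` (additive on units), a set of primes `S` on which
the Eisenstein congruence `a_p(W) ≡ p + 1` (`p ∤ N`) / `a_p(W) ≡ p` (`p ∣ N`) holds mod `ℓ`, Atkin–Lehner signs `w_Q f = ∓f`
(`−` iff `q₀ ∣ Q`) on `𝒬`, and MULTIPLICITY ONE of the sector at `(N, 𝔽_ℓ, S, 𝒬, diamondSign q₀, χ₀ ∘ mod q₀)`: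
`Λ₁(f) ≠ Λ₀(f)` and **`ℓ ∣ [Λ₀(f) : Λ₁(f)]`** — witnessed by a non-zero additive `φ : Λ₀(f) → 𝔽_ℓ` killing `Λ₁(f)` (namely a
multiple of the real-trace functional `ψ₊`, which THEOREM 54 identifies with `χ₀(d_γ)` on cusp symbols).  Inputs beyond the
tree: none but the three displayed hypotheses `hcong`, `hAL`, `hM1`. [cite: Mazur1977, II.16–II.18] [cite: Stevens1989, §2]
[cite: CremonaAlgorithms1997, §2.8] -/
theorem dvd_shimuraIndex_of_sectorMultiplicityOne_of_isNewformOf_tame {W : WeierstrassCurve ℚ} (hf : IsNewformOf W f)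
    (S 𝒬 : Finset ℕ) {q₀ : ℕ} (hq₀ : q₀.Prime) (hq₀N : q₀ ∣ N) (hℓ2 : (2 : ZMod ℓ) ≠ 0)
    (χ₀ : ZMod q₀ → ZMod ℓ) (hχ₀ : ∀ a b : ZMod q₀, IsUnit a → IsUnit b → χ₀ (a * b) = χ₀ a + χ₀ b)
    (hχ₀nt : ∃ a : ZMod q₀, IsUnit a ∧ χ₀ a ≠ 0)
    (hcong : ∀ p ∈ S, p.Prime → ((W.LFunction p : ℤ) : ZMod ℓ) = if p ∣ N then (p : ZMod ℓ) else (p : ZMod ℓ) + 1)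
    (hAL : ∀ Q ∈ 𝒬, ∀ [NeZero Q], Q ∣ N → Nat.Coprime Q (N / Q) →
      atkinLehnerInvolution N 2 Q f = ((diamondSignZ q₀ Q : ℤ) : ℂ) • f)
    (hM1 : SectorMultiplicityOne N (ZMod ℓ) S 𝒬 (diamondSign (ZMod ℓ) q₀)
      (fun x => χ₀ (ZMod.castHom hq₀N (ZMod q₀) x))) :
    ∃ φ : ↥(periodLattice f) →+ ZMod ℓ, φ ≠ 0 ∧
      (∀ (x : ℂ) (hx : x ∈ periodLatticeGamma1 f), φ ⟨x, periodLatticeGamma1_le_periodLattice f hx⟩ = 0) ∧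
      periodLatticeGamma1 f ≠ periodLattice f ∧ ℓ ∣ (periodLatticeGamma1 f).relIndex (periodLattice f) :=
  dvd_shimuraIndex_of_sectorMultiplicityOne_tame hf.1 S 𝒬 hq₀ hq₀N hℓ2 χ₀ hχ₀ hχ₀nt hAL
    (realTraceFunctional hf.1 hf.coeffField_eq_bot (ZMod ℓ)) (realTraceFunctional_ne_zero _ _ _)
    (fun p hpS hp x hx => by rw [semilinear_of_isNewformOf _ hf p x hx, hcong p hpS hp])
    (realTraceFunctional_conj _ _ _) hM1

/-- The diamond cocycle of a NON-TRIVIAL tame character is non-zero: some `γ ∈ Γ₀(N)` has `d_γ ≡ a₀ (mod q₀)` with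
`χ₀(a₀) ≠ 0` (units of `ℤ/q₀` lift to units of `ℤ/N`, which are `d`-entries by Bézout). [cite: DiamondShurman2005, §1.2] -/
theorem diamondFun_comp_ne_zero {q₀ : ℕ} (hq₀N : q₀ ∣ N) {F : Type*} [CommRing F] (χ₀ : ZMod q₀ → F)
    (hχ₀nt : ∃ a : ZMod q₀, IsUnit a ∧ χ₀ a ≠ 0) :
    diamondFun N N F (fun x => χ₀ (ZMod.castHom hq₀N (ZMod q₀) x)) ≠ 0 := by
  obtain ⟨a₀, ha₀, hne⟩ := hχ₀nt
  obtain ⟨u, hu⟩ := ZMod.unitsMap_surjective hq₀N ha₀.unit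
  obtain ⟨γ, hγ⟩ := exists_gamma0_apply_one_one_eq_of_isUnit (N := N) u.isUnit
  intro h0
  have h := congrFun (congrFun h0 γ) 0
  simp only [diamondFun_apply, Pi.zero_apply] at h
  apply hne
  have hcast : ZMod.castHom hq₀N (ZMod q₀) (u : ZMod N) = a₀ := by
    have h' := congrArg (fun v : (ZMod q₀)ˣ => (v : ZMod q₀)) hu
    simpa [ZMod.unitsMap_def] using h'
  rw [← hcast, ← hγ]
  exact h

/-- **COROLLARY 58.2 (the census form: `m = 1`).**  As COR 58.1, with multiplicity one replaced by the COMPUTED quantity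
**`dim_𝔽ℓ (sector) = 1`** (`Module.finrank` of `sectorSubmodule N 𝔽_ℓ S 𝒬 (diamondSign q₀)`; TABLE-53B / ref1 §R311: `= 1` at
67 of the 77 tame tuples `N ≤ 2000`, predicted by LAW 54.M′ `s + δ = 1`).  So at every such level, for every elliptic curve
there satisfying the Eisenstein congruence on `S` with signs `diamondSign q₀`: **`ℓ ∣ [Λ₀(f) : Λ₁(f)]`**.
[cite: Mazur1977, II.16–II.18] [cite: Stevens1989, §2] -/
theorem dvd_shimuraIndex_of_finrank_eq_one_of_isNewformOf {W : WeierstrassCurve ℚ} (hf : IsNewformOf W f)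
    (S 𝒬 : Finset ℕ) {q₀ : ℕ} (hq₀ : q₀.Prime) (hq₀N : q₀ ∣ N) (hℓ2 : (2 : ZMod ℓ) ≠ 0)
    (χ₀ : ZMod q₀ → ZMod ℓ) (hχ₀ : ∀ a b : ZMod q₀, IsUnit a → IsUnit b → χ₀ (a * b) = χ₀ a + χ₀ b)
    (hχ₀nt : ∃ a : ZMod q₀, IsUnit a ∧ χ₀ a ≠ 0)
    (hcong : ∀ p ∈ S, p.Prime → ((W.LFunction p : ℤ) : ZMod ℓ) = if p ∣ N then (p : ZMod ℓ) else (p : ZMod ℓ) + 1)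
    (hAL : ∀ Q ∈ 𝒬, ∀ [NeZero Q], Q ∣ N → Nat.Coprime Q (N / Q) →
      atkinLehnerInvolution N 2 Q f = ((diamondSignZ q₀ Q : ℤ) : ℂ) • f)
    (h1 : Module.finrank (ZMod ℓ) ↥(sectorSubmodule N (ZMod ℓ) S 𝒬 (diamondSign (ZMod ℓ) q₀)) = 1) :
    ∃ φ : ↥(periodLattice f) →+ ZMod ℓ, φ ≠ 0 ∧
      (∀ (x : ℂ) (hx : x ∈ periodLatticeGamma1 f), φ ⟨x, periodLatticeGamma1_le_periodLattice f hx⟩ = 0) ∧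
      periodLatticeGamma1 f ≠ periodLattice f ∧ ℓ ∣ (periodLatticeGamma1 f).relIndex (periodLattice f) :=
  dvd_shimuraIndex_of_sectorMultiplicityOne_of_isNewformOf_tame hf S 𝒬 hq₀ hq₀N hℓ2 χ₀ hχ₀ hχ₀nt hcong hAL
    (sectorMultiplicityOne_of_finrank_eq_one N (ZMod ℓ) S 𝒬 _ _ (diamondFun_comp_ne_zero hq₀N χ₀ hχ₀nt) h1)

end RealTrace

/-! ## §9 (imc g43, MEMO-imc §55) — LAW 55: SHIMURA RIGIDITY AT AN INADMISSIBLE PRIME, THE ADMISSIBILITY DICHOTOMY,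
AND THE UNIFIED SECTOR RANK LAW (tame `ℓ² ∥ N` AND wild `ℓ³ ∣ N`) — TYPED OBLIGATIONS (no new untagged `Prop` predicates:
the arithmetic side is `Bool`/`ℕ`-valued and decidable).

**The dichotomy (E-blind; census = ALL 150 rank-one rows of ref1 kit j342908, `N ≤ 2000`: 77 tame + 69 wild + 4 mixed; scorer
`imc/g43/law55.py`).**  Fix an odd prime `ℓ`, a level `N` with `ℓ² ∣ N`, and the CHARACTER PRIME `b` of the sector: TAME `b = q₀`
(`q₀ ≡ 1 (mod ℓ)`, `q₀ ∥ N`, `ℓ² ∥ N`) or WILD `b = ℓ` (`ℓ³ ∣ N`; the Shimura class of the conductor-`ℓ²` character `(ℤ/ℓ²)ˣ → 𝔽_ℓ`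
is parabolic iff `ℓ³ ∣ N`), `b` the only source of an order-`ℓ` parabolic Shimura class.  Call the cofactor ADMISSIBLE when every
prime `q ∣ N`, `q ∉ {ℓ, b}`, is exact (`q ∥ N`) and `q ≡ −1 (mod ℓ)` (= the tree's NET HABITAT of `…SigmaHabitat`, E-side).
* COLLAPSE: cofactor inadmissible ⟹ the sector `(U_p ≡ p, T_p ≡ 1 + p, W_Q = ε_Q, star+)` is the Shimura line: `m := star+ = 1`
  and `star− = 0` — 57/57 rows (16 by residue class `q ≢ ±1 (mod ℓ)`, 36 by a square `q² ∣ N`, 5 mixed/both), against `s + δ = 2`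
  at `1836 = 4·27·17`; THEOREM 55.B below PROVES the residue-class case (paper, from Ihara's lemma + the Atkin–Lehner trace
  identity), the square case is CONJECTURE 55.A (`SectorCollapse`).
* HABITAT (admissible), `v = v_ℓ(N) ∈ {2, 3}`: `m = s + δ_χ` with `s = #`companions `q ≡ −1 (mod ℓ)` and `δ_χ = 1` iff EVERY
  companion lies in `ker χ` (tame: `q` an `ℓ`-th power mod `q₀`; wild: `q^(ℓ−1) ≡ 1 (mod ℓ²)`, for `ℓ = 3`: `q ≡ ±1 (mod 9)`) —
  58/58 tame + 21/21 wild (`SectorRankLawUnified`); `star− = 1` on all 88 admissible rows with `v ≤ 4`.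
* WILD DEPTH `3⁴ ∥ N`: `m = 1 + s` (8/8, `SectorRankLawDepthFour`, `ℓ = 3` only: `m(625) = 2`); `v ≥ 5` tabulated, OPEN
  (`243 → 2`, `729 → 3`, each companion `+2`; `star− = v − 3`).
**COR. 55.C — why §8's `isTameTuple` carries the HABITAT CLAUSE since g43:** the g42 form (T-imc-58, f57dda4bb6a3b510) lacked it, so at
`(N, ℓ, q₀) = (4095 = 9·5·7·13, 3, 13)` it asserts `finrank = s + δ = 1 + 1 = 2` (`5 ≡ −1 (mod 3)`, `5` a cube mod `13`), while
THEOREM 55.B at the exact prime `p = 7 ≡ +1 ≢ −1 (mod 3)` of sign `+1` forces the sector into the Shimura line: `finrank = 1`.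
Pre-registered engine test P-4095 (data ask D-imc-g43-1); the laws of this section carry the clause (`isSectorTuple`: `b` is the ONLY
prime `≡ 1 (mod ℓ)` of `N`; `admissibleCofactor`).  All §9 statements impose `U_p ≡ p` at EVERY prime of `N` (`S ⊇ N.primeFactors`),
as both engines do (§8's `S ⊇ {p ≤ 13}` leaves `U_q`, `q > 13`, unimposed — uncomputed instances). -/

section LawFiftyFive

/-- RANK-ONE SECTOR TUPLE `(N, ℓ, b)` (decidable arithmetic, `Bool`-valued; primality of `ℓ`, `b` is carried as hypotheses of the
laws): `ℓ ≠ 2`, `ℓ² ∣ N`, and EITHER tame — `b ≠ ℓ`, `b ≡ 1 (mod ℓ)`, `b ∥ N`, `ℓ³ ∤ N`, and `b` is the only prime `≡ 1 (mod ℓ)`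
dividing `N` — OR wild — `b = ℓ`, `ℓ³ ∣ N`, and no prime `≡ 1 (mod ℓ)` divides `N`. [folklore] -/
def isSectorTuple (N ℓ b : ℕ) : Bool :=
  decide (ℓ ≠ 2 ∧ ℓ ^ 2 ∣ N ∧
    ((b ≠ ℓ ∧ b % ℓ = 1 ∧ b ∣ N ∧ ¬ b ^ 2 ∣ N ∧ ¬ ℓ ^ 3 ∣ N ∧ ∀ q ∈ N.primeFactors, q % ℓ = 1 → q = b) ∨
     (b = ℓ ∧ ℓ ^ 3 ∣ N ∧ ∀ q ∈ N.primeFactors, q % ℓ ≠ 1)))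

/-- ADMISSIBLE COFACTOR (the net habitat, E-blind form): every prime `q ∣ N` other than `ℓ` and the character prime `b` is exact
and `q ≡ −1 (mod ℓ)`. [folklore] -/
def admissibleCofactor (N ℓ b : ℕ) : Bool :=
  decide (∀ q ∈ N.primeFactors, q ≠ ℓ → q ≠ b → ¬ q ^ 2 ∣ N ∧ q % ℓ = ℓ - 1)

/-- `δ_χ(N, ℓ, b) ∈ {0, 1}`: `1` iff EVERY companion `q ∥ N`, `q ∉ {ℓ, b}`, `q ≡ −1 (mod ℓ)` lies in the kernel of the sector
character — tame (`b ≠ ℓ`): `q^((b−1)/ℓ) ≡ 1 (mod b)` (`q` is an `ℓ`-th power mod `q₀ = b`; equals §8's `splitDelta` for the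
discrete-log `χ₀`); wild (`b = ℓ`): `q^(ℓ−1) ≡ 1 (mod ℓ²)`. Vacuously `1`. [cite: WakeWangErickson2021, Thm. 1.5.1 (4)] -/
def charSplitDelta (N ℓ b : ℕ) : ℕ :=
  if ∀ q ∈ N.primeFactors.filter (fun q => q ≠ ℓ ∧ q ≠ b ∧ ¬ q ^ 2 ∣ N ∧ q % ℓ = ℓ - 1),
      (if b = ℓ then q ^ (ℓ - 1) % (ℓ ^ 2) = 1 else q ^ ((b - 1) / ℓ) % b = 1) then 1 else 0

-- Arithmetic side (evaluated by `imc/g43/law55.py`, not by `decide`: `Nat.primeFactors` does not reduce in the kernel):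
-- `1836 = 4·27·17` (wild, `b = ℓ = 3`): sector tuple, cofactor NOT admissible (`2² ∣ N`) although `s + δ = 1 + 1`
-- (`17 ≡ −1 (mod 9)`); measured `m = 1` (j342908).  `4095 = 9·5·7·13`, `q₀ = 13`: §8's `s + δ = 2`, but not a rank-one
-- tuple (`7 ≡ 1 (mod 3)` is a second character prime): THEOREM 55.B predicts `m = 1` (P-4095).

/-- **THEOREM 55.B — SHIMURA RIGIDITY AT AN INADMISSIBLE EXACT PRIME (imc g43, MEMO-imc §55.2; PAPER PROOF from four classical
inputs, NOT kernel-checked — hence an obligation).**  Let `p ∥ N` be prime, `p ≠ ℓ`, and `u` a parabolic weight-2 cochain mod `ℓ` on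
`Γ₀(N)` with `U_p u = p·u`.  (i) If `W_p u = u` and `p ≢ −1 (mod ℓ)` then `u` is a SHIMURA (diamond) cochain `γ ↦ θ(d_γ mod N)`, `θ`
additive on units.  (ii) If `W_p u = −u` and `p ≢ +1 (mod ℓ)` then `u = 0`.  Proof (paper): with `α = π₁^*`, `β = π_p^*` from level
`N/p`, (II) the Atkin–Lehner trace identity `α∘α_* = 1 + U_p∘W_p` on `H¹(Γ₀(N), 𝔽_ℓ)` (weight 2: `Tr F = F + F|W_p|U_p`) gives
`(1 + εp)·u = α(α_* u)`, so `u = α x` is `p`-old when `p ≢ −ε`; (III) `W_p∘α = β` (`w_p ∈ Γ₀(N/p)·diag(p,1)`) turns `W_p u = ε u`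
into `β x = ε α x`; (I) IHARA'S LEMMA (`ker(α ⊕ β)` on `ℓ`-torsion = antidiagonal Shimura subgroup; Ribet 1984 Thm. 4.1, any `ℓ`)
gives `x` Shimura for `ε = +1` and `x = −x = 0` for `ε = −1`; (IV) corestriction preserves parabolicity.  No `T`-, star- or other
`W`-condition is used.  Consequences: the residue-class half of the COLLAPSE (16/16 census rows, `ℓ ≥ 5`), the six rank-2 sector
values `m = 1` of ref1 §R313 (second prime `≡ 1 (mod ℓ)` with sign `+1`), and COR. 55.C (refutation of §8's law as typed at
`(4095, 3, 13)`). [cite: Ribet1984ICM, Thm. 4.1] [cite: AtkinLehner1970, Lemma 17] [cite: Mazur1977, II.9–II.11] -/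
@[conjecture]
def ShimuraRigidityAtInadmissiblePrime (N ℓ p : ℕ) [NeZero N] [Fact ℓ.Prime] [NeZero p] : Prop :=
  ∀ (hp : p.Prime) (hpN : p ∣ N) (hc : Nat.Coprime p (N / p)), p ≠ ℓ →
    ∀ u ∈ parSp N (ZMod ℓ), heckeU 0 N (ZMod ℓ) hp u = (p : ZMod ℓ) • u →
      (p % ℓ ≠ ℓ - 1 → alOp (ZMod ℓ) p hpN hc u = u →
          ∃ θ : ZMod N → ZMod ℓ, (∀ a b : ZMod N, IsUnit a → IsUnit b → θ (a * b) = θ a + θ b) ∧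
            u = diamondFun N N (ZMod ℓ) θ) ∧
      (p % ℓ ≠ 1 → alOp (ZMod ℓ) p hpN hc u = -u → u = 0)

/-- **CONJECTURE 55.A — SECTOR COLLAPSE OFF THE HABITAT (`SectorCollapse`; imc g43, MEMO-imc §55.1; census 57/57: every rank-one
row of j342908 with an inadmissible cofactor has `star+ = 1`, `star− = 0`).**  At a rank-one sector tuple `(N, ℓ, b)` whose cofactor is
NOT admissible (some `q ∣ N`, `q ∉ {ℓ, b}`, with `q² ∣ N` or `q ≢ −1 (mod ℓ)`), for every finite `S` containing the primes `≤ 13` and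
the primes of `N`, the Eisenstein sector of signs `ε_Q = −1 ⟺ b ∣ Q` is a LINE.  The residue-class case follows from THEOREM 55.B;
the square case `q² ∣ N` (36 + 2 rows; the `4 ∣ N` levels of the charter) is the open part — mechanism (§55.2): `U_q` lowers the level
when `q² ∣ N`, so a `U_q`-unit eigenvector is `q`-old from `N₁ = N/q^(e−1)`; `W_{q^e}∘π₁^* = π_{q^(e−1)}^*∘W_q` then forces
`π₁^* x = π_{q^(e−1)}^* x`, and the `p`-arithmetic congruence-subgroup property makes `x` a Shimura class.  Refutable per level by
one modular-symbol computation; pre-registered: `2340 = 4·9·5·13` (`s + δ = 2` on the E-side count, predicted `1`), `2916 = 4·729`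
(predicted `1` against wild depth `6`). [cite: Mazur1977, II.9–II.18] [cite: Ribet1984ICM, Thm. 4.1] -/
@[conjecture]
def SectorCollapse (N ℓ b : ℕ) [NeZero N] [Fact ℓ.Prime] (S : Finset ℕ) : Prop :=
  isSectorTuple N ℓ b = true → b.Prime → admissibleCofactor N ℓ b = false →
    (∀ p : ℕ, p.Prime → (p ≤ 13 ∨ p ∣ N) → p ∈ S) →
      Module.finrank (ZMod ℓ) ↥(sectorSubmodule N (ZMod ℓ) S (exactPrimePowerDivisors N) (diamondSign (ZMod ℓ) b)) = 1

/-- **CONJECTURE 55.U — THE UNIFIED SECTOR RANK LAW ON THE HABITAT (`SectorRankLawUnified`; imc g43, MEMO-imc §55.1; census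
79/79: 58 tame `ℓ² ∥ N` + 21 wild `ℓ³ ∥ N` admissible rows of j342908, two engines on the tame rows ≤ 1000).**  At a rank-one sector
tuple with ADMISSIBLE cofactor and `ℓ⁴ ∤ N`: `dim = s + δ_χ` (`s = minusOneCount N ℓ b`, `δ_χ = charSplitDelta N ℓ b`) — §8's
Wake–Wang-Erickson shape, now (a) WITH the habitat clause (COR. 55.C) and (b) extended to the WILD character of conductor `ℓ²`
(`b = ℓ`, `ℓ³ ∥ N`; kernel test `q^(ℓ−1) ≡ 1 (mod ℓ²)`), a regime with no counterpart in print (all cited laws have `ℓ ∤ N`).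
Pre-registered (PRED-55.tsv, 95 rows `2000 < N ≤ 3200`): `2970 = 27·2·5·11 → 3` (first `m = 3` at `v ≤ 3`), `2403, 2889 → 2`
(`89, 107 ≡ −1 (mod 9)`), `2286, 2574, 2790, 2142 → 2`, `2007, 2061, 2169, 2502 → 1`.
[cite: WakeWangErickson2021, Thm. 1.5.1, Cor. 1.6.1] [cite: Mazur1977, II.16–II.18] -/
@[conjecture]
def SectorRankLawUnified (N ℓ b : ℕ) [NeZero N] [Fact ℓ.Prime] (S : Finset ℕ) : Prop :=
  isSectorTuple N ℓ b = true → b.Prime → admissibleCofactor N ℓ b = true → ¬ ℓ ^ 4 ∣ N →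
    (∀ p : ℕ, p.Prime → (p ≤ 13 ∨ p ∣ N) → p ∈ S) →
      Module.finrank (ZMod ℓ) ↥(sectorSubmodule N (ZMod ℓ) S (exactPrimePowerDivisors N) (diamondSign (ZMod ℓ) b)) =
        minusOneCount N ℓ b + charSplitDelta N ℓ b

/-- **CONJECTURE 55.W4 — WILD DEPTH FOUR (`SectorRankLawDepthFour`, `ℓ = 3`; imc g43; census 8/8: `81, 162, 405, 810, 891, 1377,
1782, 1863`; `m(625) = 2` shows the base value depends on `ℓ`).**  `3⁴ ∥ N`, wild tuple, admissible cofactor: `dim = 1 + s`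
(every companion adds one, independently of `χ₉(q)`).  Pre-registered: `2754 = 81·2·17 → 3`, `2349 = 81·29 → 2`. Thin (8 rows):
filed as the first rung of the open wild-depth ladder `m(3^v·M)`, `v ≥ 5`. [cite: Mazur1977, II.16–II.18] -/
@[conjecture]
def SectorRankLawDepthFour (N : ℕ) [NeZero N] (S : Finset ℕ) : Prop :=
  isSectorTuple N 3 3 = true → admissibleCofactor N 3 3 = true → 3 ^ 4 ∣ N → ¬ 3 ^ 5 ∣ N →
    (∀ p : ℕ, p.Prime → (p ≤ 13 ∨ p ∣ N) → p ∈ S) →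
      Module.finrank (ZMod 3) ↥(sectorSubmodule N (ZMod 3) S (exactPrimePowerDivisors N) (diamondSign (ZMod 3) 3)) =
        1 + minusOneCount N 3 3

end LawFiftyFive

end Summit.BirchSwinnertonDyer.BirchSwinnertonDyer.Theorems.ManinLocalTwoThree.ShimuraSector

end
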